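import Mathlib
import Summits.NavierStokesRegularity.NavierStokesRegularity.Theorems.EulerZoomLiouvillePowerGaugeEulerLiouvilleSelfSimilarSwirlBudget
import Summits.NavierStokesRegularity.NavierStokesRegularity.Theorems.EulerZoomLiouvillePowerGaugeEulerLiouvilleSelfSimilarSwirlRatchetAnyAxis
import Summits.NavierStokesRegularity.NavierStokesRegularity.Theorems.EulerZoomLiouvillePowerGaugeEulerLiouvilleSelfSimilarPastConjTransport
import Summits.NavierStokesRegularity.NavierStokesRegularity.Theorems.EulerZoomLiouvillePowerGaugeEulerLiouvilleSelfSimilarSwirlRatchetPastTwins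
import Summits.NavierStokesRegularity.NavierStokesRegularity.Theorems.EulerZoomLiouvillePowerGaugeEulerLiouvilleNeedleClockPast
import HarnessLib

/-!
# Crux E `PowerGaugeEulerLiouville` (stmt-NavierStokesRegularity-19832), THE ONE STATEMENT: «THE AXISYMMETRIC NEEDLE HAS NO SWIRL» —
# ANY AXIS and PAST / SHIFTED twins of `SwirlBudget.selfSimilar_ae_eq_zero_of_axisymC2` (width seat ns-ezl-w3 g4)

Route №10 `EulerZoomLiouville` (NavierStokesRegularity), crux E; LEAD ns-typeII-p2 g12.  By-name completions of the member
`SwirlBudget.selfSimilar_ae_eq_zero_of_axisymC2` (an exactly self-similar member with an axisymmetric `C²` profile is trivial — no swirl clause, no growth):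

* `SwirlBudget.selfSimilar_ae_eq_zero_of_axisymC2_conj` — ANY AXIS through the blow-up point: `IsAxisymmetric (y ↦ R V(R⁻¹y))` for a linear isometry `R`
  (g3's transport `ClassIsometry.selfSimilar_ae_eq_zero_of_conj`);
* `SwirlBudget.selfSimilar_ae_eq_zero_of_axisymC2_past` — PAST/SHIFTED: velocity and pressure exactly self-similar about `(T, x₀)` for `τ < T₁` (`T₁ ≤ 0`, `T₁ ≤ T`),
  axisymmetric `C²` profile ⇒ trivial (classical pressure `Past.exists_isSelfSimilarEulerProfile`; CLOSED-ball budgets of the profile from the far past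
  `NeedleRace.needleBudgets_of_selfSimilarC2_past`, read on open balls; `SwirlBudget.hasNoSwirl_of_budgets`; ezl-w2's past endgame
  `NeedleRace.selfSimilar_ae_eq_zero_of_axisymNoSwirlC2_past`);
* `SwirlBudget.selfSimilar_ae_eq_zero_of_axisymC2_past_conj` — PAST + ANY AXIS (`ClassIsometry.pastSelfSimilar_ae_eq_zero_of_conj`).

For the LEAD: `IsTameSwirl` / `IsTameSwirlPast` and their `∃ R` forms can be dropped from the axisymmetric binders of `stub_selfSimilarC2Needle` and of the past
disjunct — «about no axis is `V` axisymmetric» suffices, present or past.  WHAT THIS IS NOT: not NS regularity, not the crux E — by-name strata of the crux CLASS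
19832 (MODEL lattice; E/NS strata) `--supports` stmt-19832; 19832 OPEN. [cite: Chae2007CMPEuler, Thm 2.2 + Note added p. 6; MajdaBertozziCUP2002, §1.2 Prop. 1.1 (iii)]
-/

noncomputable section

-- flat `Theorems/<Route><Decl>…` files of one crux share the namespace of the crux (tree convention: `Summit.<S>.<S>.…`)
set_option linter.dupNamespace false

open MeasureTheory Set Filter Topology Metric Function InnerProductSpace
open scoped RealInnerProductSpace NNReal ENNReal ContDiff

namespace Summit.NavierStokesRegularity.NavierStokesRegularity.Theorems.PowerGaugeEulerLiouville

namespace SwirlBudget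

open Literature.Analysis Literature.Analysis.FluidPDE Literature.Analysis.FunctionSpaces

variable {u : ℝ → EuclideanSpace ℝ (Fin 3) → EuclideanSpace ℝ (Fin 3)} {p : ℝ → EuclideanSpace ℝ (Fin 3) → ℝ}
  {H : ℝ → EuclideanSpace ℝ (Fin 3) → EuclideanSpace ℝ (Fin 3) →L[ℝ] EuclideanSpace ℝ (Fin 3)} {c : ℝ≥0}
  {V : EuclideanSpace ℝ (Fin 3) → EuclideanSpace ℝ (Fin 3)} {P : EuclideanSpace ℝ (Fin 3) → ℝ}

/-- **AXISYMMETRIC ABOUT ANY AXIS ⇒ TRIVIAL** (centred member): `selfSimilar_ae_eq_zero_of_axisymC2` with `IsAxisymmetric` read on the conjugated profile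
`y ↦ R V(R⁻¹ y)`, `R` a linear isometry of `ℝ³`. [cite: Chae2007CMPEuler, Thm 2.2 + Note added p. 6] -/
theorem selfSimilar_ae_eq_zero_of_axisymC2_conj {ρ : ℝ} (hρ : 0 < ρ) (hρ1 : ρ ≤ 1 / 2)
    (hsw : IsSuitableWeakSolutionOn (slab (EuclideanSpace ℝ (Fin 3)) (Iio 0) isOpen_Iio) 0 0 u p)
    (hH : HasWeakSpatialGradientOn (slab (EuclideanSpace ℝ (Fin 3)) (Iio 0) isOpen_Iio) u H)
    (hgauge : ∀ a : ℝ, 0 < a →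
      ENNReal.ofReal (a ^ (2 * ρ)) * cknA a (0 : ℝ × EuclideanSpace ℝ (Fin 3)) u +
          ENNReal.ofReal (a ^ ρ) * cknE a (0 : ℝ × EuclideanSpace ℝ (Fin 3)) H +
        ENNReal.ofReal (a ^ (2 * ρ)) * cknD a (0 : ℝ × EuclideanSpace ℝ (Fin 3)) p ≤ (c : ENNReal))
    (hu : ∀ τ : ℝ, τ < 0 → u τ = selfSimilarCollapse (1 / (2 + ρ)) 0 V τ)
    (hp : ∀ τ : ℝ, τ < 0 → p τ = selfSimilarCollapsePressure (1 / (2 + ρ)) 0 P τ)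
    (hV : ContDiff ℝ 2 V) (R : EuclideanSpace ℝ (Fin 3) ≃ₗᵢ[ℝ] EuclideanSpace ℝ (Fin 3))
    (hax : IsAxisymmetric (fun y => R (V (R.symm y)))) :
    uncurry u =ᵐ[volume.restrict (Iio (0 : ℝ) ×ˢ (univ : Set (EuclideanSpace ℝ (Fin 3))))] 0 := by
  -- adapted from g3's `SwirlRatchet.selfSimilar_ae_eq_zero_of_axisym_boundedSwirl_C2_conj`
  have hV' : ContDiff ℝ 2 (fun y => R (V (R.symm y))) :=
    R.toContinuousLinearEquiv.contDiff.comp (hV.comp R.symm.toContinuousLinearEquiv.contDiff)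
  exact ClassIsometry.selfSimilar_ae_eq_zero_of_conj hsw hH hgauge hu hp R fun u' p' H' hsw' hH' hg' hu' hp' =>
    selfSimilar_ae_eq_zero_of_axisymC2 hρ hρ1 hsw' hH' hg' hu' hp' hV' hax

/-- **PAST/SHIFTED TWIN: AN EXACTLY SELF-SIMILAR MEMBER ABOUT `(T, x₀)` ON A PAST WINDOW WITH AN AXISYMMETRIC `C²` PROFILE IS TRIVIAL.**  Crux binders verbatim
(`0 < ρ ≤ ½`) + velocity and pressure exactly self-similar about `(T, x₀)` for `τ < T₁` (`T₁ ≤ 0`, `T₁ ≤ T`) + `ContDiff ℝ 2 V` + `IsAxisymmetric V` ⇒ `u = 0` a.e.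
(The profile solves CIV (3.3) about the origin — `Past.exists_isSelfSimilarEulerProfile`; its closed-ball budgets `∫_{B̄_L}‖V‖² ≤ c_A L^{1−2ρ}`,
`∫_{B̄_L}‖DV‖² ≤ c_E L^{1−ρ}` (`L ≥ 1`) come from the far past — `NeedleRace.needleBudgets_of_selfSimilarC2_past`; `hasNoSwirl_of_budgets`; then
`NeedleRace.selfSimilar_ae_eq_zero_of_axisymNoSwirlC2_past`.) [cite: Chae2007CMPEuler, Thm 2.2 + Note added p. 6] -/
theorem selfSimilar_ae_eq_zero_of_axisymC2_past {ρ T T₁ : ℝ} (hρ : 0 < ρ) (hρ1 : ρ ≤ 1 / 2)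
    (hT₁ : T₁ ≤ 0) (hTT₁ : T₁ ≤ T) (x₀ : EuclideanSpace ℝ (Fin 3))
    (hsw : IsSuitableWeakSolutionOn (slab (EuclideanSpace ℝ (Fin 3)) (Iio 0) isOpen_Iio) 0 0 u p)
    (hH : HasWeakSpatialGradientOn (slab (EuclideanSpace ℝ (Fin 3)) (Iio 0) isOpen_Iio) u H)
    (hgauge : ∀ a : ℝ, 0 < a →
      ENNReal.ofReal (a ^ (2 * ρ)) * cknA a (0 : ℝ × EuclideanSpace ℝ (Fin 3)) u +
          ENNReal.ofReal (a ^ ρ) * cknE a (0 : ℝ × EuclideanSpace ℝ (Fin 3)) H +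
        ENNReal.ofReal (a ^ (2 * ρ)) * cknD a (0 : ℝ × EuclideanSpace ℝ (Fin 3)) p ≤ (c : ENNReal))
    (hu : ∀ τ : ℝ, τ < T₁ → u τ = fun x => selfSimilarCollapse (1 / (2 + ρ)) T V τ (x - x₀))
    (hp : ∀ τ : ℝ, τ < T₁ → p τ = fun x => selfSimilarCollapsePressure (1 / (2 + ρ)) T P τ (x - x₀))
    (hV : ContDiff ℝ 2 V) (hax : IsAxisymmetric V) :
    uncurry u =ᵐ[volume.restrict (Iio (0 : ℝ) ×ˢ (univ : Set (EuclideanSpace ℝ (Fin 3))))] 0 := by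
  have h2ρ : (0 : ℝ) < 2 + ρ := by linarith
  have hγ0 : (0 : ℝ) < 1 / (2 + ρ) := one_div_pos.2 h2ρ
  have hγ2 : 1 / (2 + ρ) < 1 / 2 := one_div_lt_one_div_of_lt two_pos (by linarith)
  have hA : ∀ a : ℝ, 0 < a → ENNReal.ofReal (a ^ (2 * ρ)) *
      cknA a (0 : ℝ × EuclideanSpace ℝ (Fin 3)) u ≤ (c : ℝ≥0∞) :=
    fun a ha => le_trans (le_trans le_self_add le_self_add) (hgauge a ha)
  have hE : ∀ a : ℝ, 0 < a → ENNReal.ofReal (a ^ ρ) *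
      cknE a (0 : ℝ × EuclideanSpace ℝ (Fin 3)) H ≤ (c : ℝ≥0∞) :=
    fun a ha => le_trans (le_trans le_add_self le_self_add) (hgauge a ha)
  -- a classical pressure about the origin and the class budgets on closed balls
  obtain ⟨P', hprof⟩ := Past.exists_isSelfSimilarEulerProfile hρ hT₁ hTT₁ hsw.distributional hu hp hV
  obtain ⟨-, cA, cE, hcA, hcE, hbA, hbE⟩ :=
    NeedleRace.needleBudgets_of_selfSimilarC2_past hρ hρ1 hT₁ hTT₁ x₀ hsw.distributional hH hA hE hu hp hV
  -- no swirl, by the budgets alone (open balls inside closed balls)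
  have hns : HasNoSwirl V :=
    hasNoSwirl_of_budgets hprof hax hγ0 hγ2 hcA hcE (by linarith : 1 - 2 * ρ < 3) (by linarith : 1 - ρ < 1)
      (fun L hL => (lintegral_mono_set ball_subset_closedBall).trans (hbA L hL))
      (fun L hL => (lintegral_mono_set ball_subset_closedBall).trans (hbE L hL))
  exact NeedleRace.selfSimilar_ae_eq_zero_of_axisymNoSwirlC2_past hρ hρ1 hT₁ hTT₁ x₀ hsw hH hgauge hu hp hV hax hns

/-- **PAST + ANY AXIS**: `selfSimilar_ae_eq_zero_of_axisymC2_past` with `IsAxisymmetric` read on the conjugated profile `y ↦ R V(R⁻¹ y)`.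
[cite: Chae2007CMPEuler, Thm 2.2 + Note added p. 6] -/
theorem selfSimilar_ae_eq_zero_of_axisymC2_past_conj {ρ T T₁ : ℝ} (hρ : 0 < ρ) (hρ1 : ρ ≤ 1 / 2)
    (hT₁ : T₁ ≤ 0) (hTT₁ : T₁ ≤ T) (x₀ : EuclideanSpace ℝ (Fin 3))
    (hsw : IsSuitableWeakSolutionOn (slab (EuclideanSpace ℝ (Fin 3)) (Iio 0) isOpen_Iio) 0 0 u p)
    (hH : HasWeakSpatialGradientOn (slab (EuclideanSpace ℝ (Fin 3)) (Iio 0) isOpen_Iio) u H)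
    (hgauge : ∀ a : ℝ, 0 < a →
      ENNReal.ofReal (a ^ (2 * ρ)) * cknA a (0 : ℝ × EuclideanSpace ℝ (Fin 3)) u +
          ENNReal.ofReal (a ^ ρ) * cknE a (0 : ℝ × EuclideanSpace ℝ (Fin 3)) H +
        ENNReal.ofReal (a ^ (2 * ρ)) * cknD a (0 : ℝ × EuclideanSpace ℝ (Fin 3)) p ≤ (c : ENNReal))
    (hu : ∀ τ : ℝ, τ < T₁ → u τ = fun x => selfSimilarCollapse (1 / (2 + ρ)) T V τ (x - x₀))
    (hp : ∀ τ : ℝ, τ < T₁ → p τ = fun x => selfSimilarCollapsePressure (1 / (2 + ρ)) T P τ (x - x₀))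
    (hV : ContDiff ℝ 2 V) (R : EuclideanSpace ℝ (Fin 3) ≃ₗᵢ[ℝ] EuclideanSpace ℝ (Fin 3))
    (hax : IsAxisymmetric (fun y => R (V (R.symm y)))) :
    uncurry u =ᵐ[volume.restrict (Iio (0 : ℝ) ×ˢ (univ : Set (EuclideanSpace ℝ (Fin 3))))] 0 := by
  -- adapted from g3's `SwirlRatchet.selfSimilar_ae_eq_zero_of_axisym_boundedSwirl_C2_past_conj`
  have hV' : ContDiff ℝ 2 (fun y => R (V (R.symm y))) :=
    R.toContinuousLinearEquiv.contDiff.comp (hV.comp R.symm.toContinuousLinearEquiv.contDiff)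
  exact ClassIsometry.pastSelfSimilar_ae_eq_zero_of_conj x₀ hsw hH hgauge hu hp R fun u' p' H' hsw' hH' hg' hu' hp' =>
    selfSimilar_ae_eq_zero_of_axisymC2_past hρ hρ1 hT₁ hTT₁ (R x₀) hsw' hH' hg' hu' hp' hV' hax

end SwirlBudget

end Summit.NavierStokesRegularity.NavierStokesRegularity.Theorems.PowerGaugeEulerLiouville

end
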